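import Summits.CriticalPhenomena.PercolationContinuityZ3.Theorems.PercNearOneGluingNoHeavyQuantKnScaleDefect
import Summits.CriticalPhenomena.PercolationContinuityZ3.Theorems.PercNearOneGluingNoHeavyQuantTowerCount
import Mathlib.Analysis.Complex.ExponentialBounds
import HarnessLib
import HarnessLib.Audit.Tags

/-!
# QUANT lane R7a complement: the explicit one-arm rate at `p_c(ℤ^d)` decays NO FASTER than an inverse tower of height two

builds on p205010 (kernel theorem, internal audit signed; external expert review pending)

Cell `prim-quant`, seat `prim-quant-p3` (generation 2).  The lane's kernel theorem `Quant.oneArm_explicit_rate_criticalProbI`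
(p208976, `…QuantKnScaleDefect.lean`) reads `π_{p_c}(N) ≤ (1 - knEta d)^{iterCount (knLHi d) N}`; seat p4 (R7a,
`…QuantTowerCount.lean`, `…QuantKnLHiTower.lean`) bounds the window top `knLHi d m` from ABOVE by a height-3 tower and hence
`iterCount (knLHi d) N` from BELOW by `⌊log*_b N / 3⌋`.  This file is the other half of the honest sentence "an explicit function
tending to `0` and nothing more": the two exponentials of Kozma–Nitzan's Lemma 10 (Step III seeds `knSeeds ≥ 64^(seedBound)`,
Step II levels `knRad ≥ 64^(2d·Ncont)`) are really there, so

* `Quant.knLHi_ge_tower` — `2^(2^(2m+5)) ≤ knLHi d m` for every `m` (`d ≥ 1`);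
* `Quant.scaleSeq_knLHi_ge` — `(x ↦ 2^(2^(2x+7)))^[j] (knLHi d 2) ≤ scaleSeq (knLHi d) (j+1)`, hence
  `Quant.tower_le_scaleSeq_knLHi` — `tower 2 (2j) ≤ scaleSeq (knLHi d) (j+1)`;
* `Quant.iterCount_knLHi_le` — `iterCount (knLHi d) N ≤ j` whenever `N < (x ↦ 2^(2^(2x+7)))^[j] (knLHi d 2)`, and
  **`Quant.two_mul_iterCount_knLHi_le`** — `2 · iterCount (knLHi d) N ≤ logStar 2 N + 2` for all `N`:
  the exponent of the lane's rate is at most `log*_2(N)/2 + 1`, i.e. the bound `(1 - knEta d)^(iterCount (knLHi d) N)` is never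
  smaller than `(1 - knEta d)^(log*_2 N / 2 + 1)` — inverse-tower decay and nothing more.
[cite: KozmaNitzan2024, §4 Lemma 10 Steps II–III (seed and level counts)] [cite: DuminilcopinKozmaTassion2020, Proposition 1]
-/

noncomputable section

namespace Summit.CriticalPhenomena.PercolationContinuityZ3.Theorems.Quant

open MeasureTheory Literature.Probability.Percolation Literature.Probability.LatticeModels
open Literature.Probability.Percolation.KozmaNitzan Literature.Probability.Percolation.AKN
open Literature.Probability.Percolation.GM (HOct)

variable {d : ℕ}

/-! ## Two constant bounds -/

/-- `64 ≤ 1/critDelta d` for `d ≥ 1`. builds on p205010 (kernel theorem, internal audit signed; external expert review pending). [folklore] -/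
theorem le_one_div_critDelta (hd : 1 ≤ d) : (64 : ℝ) ≤ 1 / critDelta d := by
  have h := critDelta_pos hd
  have h64 : critDelta d ≤ 1 / 64 := min_le_right _ _
  rw [le_div_iff₀ h]
  have := mul_le_mul_of_nonneg_left h64 (by norm_num : (0 : ℝ) ≤ 64)
  linarith

/-- `1 ≤ log(1/δ_E)` (since `δ_E ≤ 1/3 < 1/e`). builds on p205010 (kernel theorem, internal audit signed; external expert review pending). [folklore] -/
theorem one_le_log_one_div_knDeltaE (d : ℕ) : 1 ≤ Real.log (1 / knDeltaE d) := by
  have hpos : 0 < 1 / knDeltaE d := one_div_pos.2 (knDeltaE_pos d)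
  rw [Real.le_log_iff_exp_le hpos]
  have h3 : Real.exp 1 < 3 := lt_trans Real.exp_one_lt_d9 (by norm_num)
  have hE : knDeltaE d ≤ 1 / 3 := by
    have h1 := knDeltaE_le_delta d
    have : knDelta ≤ 1 / 3 := by unfold knDelta; have := knEps_le_one; have := knEps_pos; linarith
    linarith
  have : (3 : ℝ) ≤ 1 / knDeltaE d := by
    rw [le_div_iff₀ (knDeltaE_pos d)]; linarith
  linarith


/-! ## Lower bounds: two exponential levels are really there -/

/-- `2^{12 d · Ncont} ≤ knLHi d m` (Step II's level count at base `1/critDelta ≥ 64`).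
builds on p205010 (kernel theorem, internal audit signed; external expert review pending). [folklore] -/
theorem two_pow_Ncont_le_knLHi (hd : 1 ≤ d) (m : ℕ) :
    2 ^ (12 * d * LData.Ncont d (knM d m) (knSeeds d m)) ≤ knLHi d m := by
  have h64 := le_one_div_critDelta hd
  have hreal : ((2 ^ (12 * d * LData.Ncont d (knM d m) (knSeeds d m)) : ℕ) : ℝ) ≤
      (1 / critDelta d) ^ (2 * d * LData.Ncont d (knM d m) (knSeeds d m)) / knDelta := by
    have h1 : ((2 ^ (12 * d * LData.Ncont d (knM d m) (knSeeds d m)) : ℕ) : ℝ) =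
        (64 : ℝ) ^ (2 * d * LData.Ncont d (knM d m) (knSeeds d m)) := by
      push_cast
      rw [show (64 : ℝ) = 2 ^ 6 by norm_num, ← pow_mul]; ring_nf
    rw [h1]
    have h2 : (64 : ℝ) ^ (2 * d * LData.Ncont d (knM d m) (knSeeds d m)) ≤
        (1 / critDelta d) ^ (2 * d * LData.Ncont d (knM d m) (knSeeds d m)) := pow_le_pow_left₀ (by norm_num) h64 _
    have h3 : (1 / critDelta d) ^ (2 * d * LData.Ncont d (knM d m) (knSeeds d m)) ≤
        (1 / critDelta d) ^ (2 * d * LData.Ncont d (knM d m) (knSeeds d m)) / knDelta :=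
      le_div_self (by positivity) knDelta_pos knDelta_le_one
    exact h2.trans h3
  have hceil : 2 ^ (12 * d * LData.Ncont d (knM d m) (knSeeds d m)) ≤
      ⌈(1 / critDelta d) ^ (2 * d * LData.Ncont d (knM d m) (knSeeds d m)) / knDelta⌉₊ := by
    have := hreal.trans (Nat.le_ceil _)
    exact_mod_cast this
  have hRT : 2 ^ (12 * d * LData.Ncont d (knM d m) (knSeeds d m)) ≤ knRT d m := by
    unfold knRT knRad; omega
  have h1 := two_knRT_le_knS d m
  have h2 := knS_le_knR d m
  unfold knLHi; omega

/-- `2^{6·seedBound d M} ≤ knSeeds d m` (Step III's seed count at base `1/critDelta ≥ 64`, using `log(1/δ_E) ≥ 1`).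
builds on p205010 (kernel theorem, internal audit signed; external expert review pending). [folklore] -/
theorem knSeeds_ge_two_pow (hd : 1 ≤ d) (m : ℕ) : 2 ^ (6 * seedBound d (knM d m)) ≤ knSeeds d m := by
  unfold knSeeds
  set sB := seedBound d (knM d m)
  have hreal : ((2 ^ (6 * sB) : ℕ) : ℝ) ≤ Real.log (1 / knDeltaE d) / critDelta d ^ sB := by
    have h0 : Real.log (1 / knDeltaE d) / critDelta d ^ sB = Real.log (1 / knDeltaE d) * (1 / critDelta d) ^ sB := by
      rw [one_div_pow]; field_simp
    rw [h0]
    have h1 : ((2 ^ (6 * sB) : ℕ) : ℝ) = (64 : ℝ) ^ sB := by push_cast; rw [pow_mul]; norm_num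
    rw [h1]
    have h2 : (64 : ℝ) ^ sB ≤ (1 / critDelta d) ^ sB := pow_le_pow_left₀ (by norm_num) (le_one_div_critDelta hd) _
    have h3 := one_le_log_one_div_knDeltaE d
    calc (64 : ℝ) ^ sB = 1 * 64 ^ sB := (one_mul _).symm
      _ ≤ Real.log (1 / knDeltaE d) * (1 / critDelta d) ^ sB := mul_le_mul h3 h2 (by positivity) (by linarith)
  exact_mod_cast hreal.trans (Nat.le_ceil _)

/-- `knSeeds ≤ Ncont` (the separation box is nonempty). builds on p205010 (kernel theorem, internal audit signed; external expert review pending). [folklore] -/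
theorem knSeeds_le_Ncont (d m : ℕ) : knSeeds d m ≤ LData.Ncont d (knM d m) (knSeeds d m) := by
  unfold LData.Ncont
  rw [card_box]
  exact Nat.le_mul_of_pos_right _ (by positivity)

/-- **`2^(2^(2m+5)) ≤ knLHi d m`** for every `m`: the window top grows at least like a tower of height two.
builds on p205010 (kernel theorem, internal audit signed; external expert review pending).
[cite: KozmaNitzan2024, §4 Lemma 10 Steps II–III] -/
theorem knLHi_ge_tower (hd : 1 ≤ d) (m : ℕ) : 2 ^ (2 ^ (2 * m + 5)) ≤ knLHi d m := by
  have h1 := two_pow_Ncont_le_knLHi hd m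
  have h2 := knSeeds_le_Ncont d m
  have h3 := knSeeds_ge_two_pow hd m
  have h4 : 2 * m + 5 ≤ 6 * seedBound d (knM d m) := by
    have hM := lt_knM d m
    unfold seedBound
    have h5 : 2 * knM d m + 3 ≤ (2 * knM d m + 3) ^ d := by
      calc 2 * knM d m + 3 = (2 * knM d m + 3) ^ 1 := (pow_one _).symm
        _ ≤ _ := Nat.pow_le_pow_right (by omega) hd
    have h6 : (2 * knM d m + 3) ^ d ≤ (2 * d + 1) * (2 * knM d m + 3) ^ d := Nat.le_mul_of_pos_left _ (by omega)
    omega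
  calc 2 ^ (2 ^ (2 * m + 5)) ≤ 2 ^ (2 ^ (6 * seedBound d (knM d m))) :=
        Nat.pow_le_pow_right (by norm_num) (Nat.pow_le_pow_right (by norm_num) h4)
    _ ≤ 2 ^ knSeeds d m := Nat.pow_le_pow_right (by norm_num) h3
    _ ≤ 2 ^ LData.Ncont d (knM d m) (knSeeds d m) := Nat.pow_le_pow_right (by norm_num) h2
    _ ≤ 2 ^ (12 * d * LData.Ncont d (knM d m) (knSeeds d m)) :=
        Nat.pow_le_pow_right (by norm_num) (Nat.le_mul_of_pos_left _ (by omega))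
    _ ≤ knLHi d m := h1

/-! ## The scale sequence from below and the exponent from above -/

/-- The lower comparison tower `x ↦ 2^(2^(2x+7))` is monotone. builds on p205010 (kernel theorem, internal audit signed; external expert review pending). [folklore] -/
theorem lowerStep_mono : Monotone (fun x : ℕ => 2 ^ (2 ^ (2 * x + 7))) := fun a b h =>
  Nat.pow_le_pow_right (by norm_num) (Nat.pow_le_pow_right (by norm_num) (by omega))

/-- The first scale `s 1 = knLHi d 2` lies below every later one. builds on p205010 (kernel theorem, internal audit signed; external expert review pending). [folklore] -/
theorem knLHi_two_le_scaleSeq (d j : ℕ) : knLHi d 2 ≤ scaleSeq (knLHi d) (j + 1) := by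
  have hmono := (strictMono_scaleSeq (L := knLHi d) (le_knLHi d)).monotone
  calc knLHi d 2 = scaleSeq (knLHi d) 1 := rfl
    _ ≤ scaleSeq (knLHi d) (j + 1) := hmono (by omega)

/-- **Lower tower for the scale sequence**: `(x ↦ 2^(2^(2x+7)))^[j] (knLHi d 2) ≤ s (j+1)`.
builds on p205010 (kernel theorem, internal audit signed; external expert review pending). [folklore] -/
theorem scaleSeq_knLHi_ge (hd : 1 ≤ d) (j : ℕ) :
    (fun x : ℕ => 2 ^ (2 ^ (2 * x + 7)))^[j] (knLHi d 2) ≤ scaleSeq (knLHi d) (j + 1) := by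
  induction j with
  | zero => exact le_of_eq rfl
  | succ j ih =>
    rw [Function.iterate_succ_apply', scaleSeq_succ]
    set s := scaleSeq (knLHi d) (j + 1) with hs
    have hmono := lowerStep_mono ih
    dsimp only at hmono ⊢
    calc 2 ^ (2 ^ (2 * ((fun x : ℕ => 2 ^ (2 ^ (2 * x + 7)))^[j] (knLHi d 2)) + 7)) ≤ 2 ^ (2 ^ (2 * s + 7)) := hmono
      _ = 2 ^ (2 ^ (2 * (s + 1) + 5)) := by ring_nf
      _ ≤ knLHi d (s + 1) := knLHi_ge_tower hd (s + 1)

/-- **The matching upper bound on the exponent**: if `N < (x ↦ 2^(2^(2x+7)))^[j] (knLHi d 2)` then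
`iterCount (knLHi d) N ≤ j` — the rate `(1 - knEta d)^{iterCount (knLHi d) N}` of `oneArm_explicit_rate_criticalProbI`
decays no faster than an inverse tower of height two per factor.
builds on p205010 (kernel theorem, internal audit signed; external expert review pending). [folklore] -/
theorem iterCount_knLHi_le (hd : 1 ≤ d) {j N : ℕ} (hN : N < (fun x : ℕ => 2 ^ (2 ^ (2 * x + 7)))^[j] (knLHi d 2)) :
    iterCount (knLHi d) N ≤ j := by
  by_contra h'
  have h : j + 1 ≤ iterCount (knLHi d) N := by omega
  rcases Nat.eq_zero_or_pos N with rfl | hNpos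
  · have := iterCount_le (knLHi d) 0; omega
  have hmono := (strictMono_scaleSeq (L := knLHi d) (le_knLHi d)).monotone
  have h1 : scaleSeq (knLHi d) (j + 1) ≤ scaleSeq (knLHi d) (iterCount (knLHi d) N) := hmono h
  have h2 := scaleSeq_iterCount_le (L := knLHi d) hNpos
  have h3 := scaleSeq_knLHi_ge hd j
  omega


/-! ## The `log*` form -/

/-- `iterExp 2 (2j) x ≤ (x ↦ 2^(2^(2x+7)))^[j] x`: two plain exponentials per lower-tower step.
builds on p205010 (kernel theorem, internal audit signed; external expert review pending). [folklore] -/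
theorem iterExp_two_le_lowerIter (j x : ℕ) : iterExp 2 (2 * j) x ≤ (fun x : ℕ => 2 ^ (2 ^ (2 * x + 7)))^[j] x := by
  induction j with
  | zero => simp [iterExp]
  | succ j ih =>
    rw [Function.iterate_succ_apply']
    have h2 : 2 * (j + 1) = (2 * j + 1) + 1 := by ring
    rw [h2, iterExp_succ, iterExp_succ]
    exact Nat.pow_le_pow_right (by norm_num) (Nat.pow_le_pow_right (by norm_num) (by omega))

/-- **`tower 2 (2j) ≤ scaleSeq (knLHi d) (j+1)`**: the `(j+1)`-st scale of the lane's rate is at least a tower of `2j` twos.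
builds on p205010 (kernel theorem, internal audit signed; external expert review pending). [folklore] -/
theorem tower_le_scaleSeq_knLHi (hd : 1 ≤ d) (j : ℕ) : tower 2 (2 * j) ≤ scaleSeq (knLHi d) (j + 1) := by
  have h1 : 1 ≤ knLHi d 2 := le_trans (by norm_num) (le_knLHi d 2)
  calc tower 2 (2 * j) = iterExp 2 (2 * j) 1 := rfl
    _ ≤ iterExp 2 (2 * j) (knLHi d 2) := iterExp_mono (by norm_num) _ h1
    _ ≤ (fun x : ℕ => 2 ^ (2 ^ (2 * x + 7)))^[j] (knLHi d 2) := iterExp_two_le_lowerIter j _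
    _ ≤ scaleSeq (knLHi d) (j + 1) := scaleSeq_knLHi_ge hd j

/-- **`2 · iterCount (knLHi d) N ≤ log*_2(N) + 2`** for every `N` (`d ≥ 1`): the exponent of the explicit rate
`π_{p_c}(N) ≤ (1 - knEta d)^(iterCount (knLHi d) N)` is at most `log*_2(N)/2 + 1` — with p4's lower bound `⌊log*_b N/3⌋ ≤ iterCount`
(R7a) the rate is `(1 - η_d)^{Θ(log* N)}`: an explicit function tending to `0` and nothing more.
builds on p205010 (kernel theorem, internal audit signed; external expert review pending).
[cite: KozmaNitzan2024, §4 Lemma 10 Steps II–III] -/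
theorem two_mul_iterCount_knLHi_le (hd : 1 ≤ d) (N : ℕ) : 2 * iterCount (knLHi d) N ≤ logStar 2 N + 2 := by
  rcases Nat.eq_zero_or_pos N with rfl | hN
  · have := iterCount_le (knLHi d) 0; omega
  rcases Nat.eq_zero_or_pos (iterCount (knLHi d) N) with h0 | hI
  · omega
  obtain ⟨i, hi⟩ : ∃ i, iterCount (knLHi d) N = i + 1 := ⟨iterCount (knLHi d) N - 1, by omega⟩
  have hs : scaleSeq (knLHi d) (i + 1) ≤ N := by rw [← hi]; exact scaleSeq_iterCount_le hN
  have ht : tower 2 (2 * i) ≤ N := (tower_le_scaleSeq_knLHi hd i).trans hs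
  have hl : 2 * i ≤ logStar 2 N := (le_logStar_iff (by norm_num) hN).2 ht
  omega

end Summit.CriticalPhenomena.PercolationContinuityZ3.Theorems.Quant
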